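import Summits.AtomisticToContinuum.HydrodynamicLimit.Theses.JParityClosure
import Summits.AtomisticToContinuum.HydrodynamicLimit.Theorems.JParityClosureParityBandClosureParityStabilityOfRigidityA
import Mathlib.MeasureTheory.Measure.ProbabilityMeasure
import Mathlib.MeasureTheory.Measure.FiniteMeasure
import HarnessLib

/-!
# Parity stability from the four measure-theoretic waypoints
(stub `stub_parityStabilityOfRigidity` of the line `transfer-weighted-parity-chain`, skeleton v3, crux
`JParityClosure.ParityBandClosure`, stmt-AtomisticToContinuum-17608)

WHAT. §1 copies VERBATIM the five registered waypoint statements of the skeleton — `ParityStability`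
(quantitative single-pair rigidity: finitely many Metropolis-odd / floor / balance tests passed within
`η` force `ε`-isotropic central second moments), `ExactParityRigidity` (its `η = 0` case),
`SurprisalTestContinuity`, `MomentSemicontinuity`, `CountableTestUpgrade` — route-internal stub
signatures, not cited facts.  §2 proves the registered stub `stub_parityStabilityOfRigidity :
ExactParityRigidity → SurprisalTestContinuity → MomentSemicontinuity → CountableTestUpgrade →
ParityStability` (the compactness ASSEMBLY; the four antecedents are the other stubs of the wave).

PROOF. Fix `(M, cmin, ε)` and the countable families `(Φ₀, Ξ₀, C₀, ϑ₀)` of `CountableTestUpgrade`;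
suppose no finite test family works. (1) Stage `n` uses the first `n` tests — `Ψ_j = Φ_i − Φ_i ∘ J`
at bandwidth `ϑ_k`, `(i, k) = Nat.unpair j` (continuous, bounded, `J`-odd: `oddTest_props`),
`Ξ_j = Ξ₀ j`, `c_j = C₀ j` — with tolerance `1/(n+1)`; a failing triple `(ν_n, κ_n, c₀ⁿ)` exists for
every `n` (`choose`). (2) `exists_subseq_pair` (helper file A: Markov tightness from the moment bounds,
Prokhorov, metrizability of `ProbabilityMeasure ℝ³`, sequential Prokhorov for finite measures on `Q`)
extracts `φ` with `ν_{φ n} → ν`, `κ_{φ n} → κ` weakly. (3) `MomentSemicontinuity` transfers the cubic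
bound to `ν` (hence the quadratic one, `integrable_sq_of_cube`) and the quadratic bound to `κ`, and
gives convergence of the first and second raw moments of `ν_{φ n}`. (4) Limit identities: the test
`(i, k)` is active from stage `Nat.pair i k + 1` on with tolerance `1/(φ n + 1) → 0` (`φ n ≥ n`), so by
the squeeze `limit_eq_zero_of_abs_le` (o) vanishes in the limit by `SurprisalTestContinuity` (the
`let F` of the waypoints is, definitionally, the local `Fs`), (b) vanishes by weak convergence against the
bounded continuous balance integrand (`balanceTest_props`, `tendsto_integral_of_tendsto`), and (f)
holds with the constant `cmin` by the floor clause of `MomentSemicontinuity` along the subsequence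
SHIFTED by `i + 1`, `b_m = (∫ Ξ₀ i dκ_{φ(m+i+1)} + 1/(φ(m+i+1)+1)) / cmin → (∫ Ξ₀ i dκ) / cmin` (floor
integral `≥ 0`, `c₀ⁿ ≥ cmin`: `floor_le_div`). (5) `CountableTestUpgrade` with `c₀ := cmin` yields the
three exact hypotheses and `ExactParityRigidity` an exactly isotropic `(θ, u)` for `ν`. (6) By (3) and
`tendsto_central` the means and central second moments of `ν_{φ n}` are within `ε` of `(u, θ𝟙)` for
`n` large (finitely many indices, `Filter.eventually_all`) — contradicting the failure at stage `φ n`.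

REFERENCES. P. Billingsley, *Convergence of Probability Measures*, 2nd ed., Wiley 1999, Thms 5.1–5.2
(Prokhorov), §2 (weak convergence); C. Cercignani, R. Illner, M. Pulvirenti, *The Mathematical Theory
of Dilute Gases*, Springer 1994, §3.1–3.3.  The measure-level parity chain itself is the landed
p139072 → p138663 → p139366 → p137939; this file is only the compactness bookkeeping around it.
-/

noncomputable section

namespace Summit.AtomisticToContinuum.HydrodynamicLimit.Theorems.ParityBandClosureStabilityAssembly

open scoped BigOperators Topology Classical MeasureTheory ENNReal InnerProductSpace
open Filter Set MeasureTheory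
open Literature.MathematicalPhysics.KineticTheory Literature.Analysis.FluidPDE

/-! ## §1 The five registered waypoint statements (VERBATIM the skeleton v3) -/

/-- Registered stub signature (waypoint, skeleton v3 of line `transfer-weighted-parity-chain`, crux
`ParityBandClosure`, stmt-AtomisticToContinuum-17608; route-internal, not a cited fact; body VERBATIM):
**Parity stability (single pair, quantitative; the landed measure-level chain made uniform).**  For every moment
bound `M`, floor constant `cmin > 0` and `ε > 0` there are finitely many tests — bounded continuous `J`-odd marks `Ψ_j`
(`J(p,ω) = (collide ω p, −ω)`) with mollifier scales `ϑ_j ∈ (0,1)`, bounded continuous floor marks `Ξ_j ≥ 0`, bounded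
continuous balance tests `c_j` — and `η > 0` such that: whenever a probability law `ν` on `ℝ³` (`∫|v|³ ≤ M`) and a finite
record `κ` on `(ℝ³×ℝ³)×S²` (mass and second moments `≤ M`) satisfy (o) `|∫Ψ_j min(1,e^{−F^ν_{ϑ_j}}) dκ| ≤ η`,
(f) `c₀∫Ξ_j B d(ν⊗ν⊗dω) ≤ ∫Ξ_j dκ + η` with `c₀ ≥ cmin`, (b) `|∫Δc_j dκ| ≤ η`, then the central second-moment tensor of `ν`
is `ε`-close to `θ𝟙` for some `θ ≥ 0`.  `F^ν_ϑ(p,ω) = log h(p.1)h(p.2) − log h(p′.1)h(p′.2)`, `h = ν ⋆ G_{ϑ²}`, `p′ = collide ω p`,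
`B = hardSphereKernel (w, v) ω = ((w−v)·ω)₊` — VERBATIM the conventions of `ParityRigidity` / p138663 / p139366.  Proof route in
the file header (contradiction + tightness + continuity of `(ν,κ) ↦ ∫Ψ min(1,e^{−F^ν_ϑ})dκ` at FIXED `ϑ > 0` + the landed
chain at every `ϑ ∈ (0,1)`).  Satisfiable hypotheses for every choice of tests (Maxwellian `ν`, `κ = c₀(ν⊗ν)B dω`), so the
`∃`-data cannot be gamed. -/
def ParityStability : Prop :=
  ∀ (M cmin ε : ℝ), 0 < cmin → 0 < ε →
    ∃ (n : ℕ) (Ψs : Fin n → (V3 × V3) × Metric.sphere (0 : V3) 1 → ℝ)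
      (Ξs : Fin n → (V3 × V3) × Metric.sphere (0 : V3) 1 → ℝ) (cs : Fin n → V3 → ℝ) (ϑs : Fin n → ℝ) (η : ℝ),
      0 < η ∧
      (∀ j, Continuous (Ψs j) ∧ (∃ C : ℝ, ∀ q, |Ψs j q| ≤ C) ∧ (∀ q, Ψs j (collide q.2 q.1, -q.2) = -Ψs j q)) ∧
      (∀ j, Continuous (Ξs j) ∧ (∀ q, 0 ≤ Ξs j q) ∧ (∃ C : ℝ, ∀ q, Ξs j q ≤ C)) ∧
      (∀ j, Continuous (cs j) ∧ (∃ C : ℝ, ∀ v, |cs j v| ≤ C)) ∧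
      (∀ j, 0 < ϑs j ∧ ϑs j < 1) ∧
      ∀ (ν : Measure V3) [IsProbabilityMeasure ν] (κ : Measure ((V3 × V3) × Metric.sphere (0 : V3) 1))
        [IsFiniteMeasure κ] (c₀ : ℝ), cmin ≤ c₀ →
        Integrable (fun v : V3 => ‖v‖ ^ 3) ν → ∫ v, ‖v‖ ^ 3 ∂ν ≤ M →
        (κ Set.univ).toReal ≤ M →
        Integrable (fun q : (V3 × V3) × Metric.sphere (0 : V3) 1 => ‖q.1.1‖ ^ 2 + ‖q.1.2‖ ^ 2) κ →
        ∫ q, (‖q.1.1‖ ^ 2 + ‖q.1.2‖ ^ 2) ∂κ ≤ M →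
        let h : ℝ → V3 → ℝ := fun ϑ v => ∫ v', localMaxwellian 1 (ϑ ^ 2) v v' ∂ν
        let F : ℝ → (V3 × V3) × Metric.sphere (0 : V3) 1 → ℝ := fun ϑ q =>
          Real.log (h ϑ q.1.1) + Real.log (h ϑ q.1.2) -
            Real.log (h ϑ (collide q.2 q.1).1) - Real.log (h ϑ (collide q.2 q.1).2)
        (∀ j, |∫ q, Ψs j q * min 1 (Real.exp (-(F (ϑs j) q))) ∂κ| ≤ η) →
        (∀ j, c₀ * ∫ q, Ξs j q * hardSphereKernel (q.1.2, q.1.1) q.2 ∂((ν.prod ν).prod sphereMeasure) ≤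
          (∫ q, Ξs j q ∂κ) + η) →
        (∀ j, |∫ q, (cs j (collide q.2 q.1).1 + cs j (collide q.2 q.1).2 - cs j q.1.1 - cs j q.1.2) ∂κ| ≤ η) →
        ∃ θ : ℝ, 0 ≤ θ ∧ ∃ u : V3, (∀ j : Fin 3, |(∫ v, v j ∂ν) - u j| ≤ ε) ∧
          ∀ j k : Fin 3, |(∫ v, (v j - u j) * (v k - u k) ∂ν) - (if j = k then θ else 0)| ≤ ε

/-! ### §1c The four measure-theoretic waypoints of `ParityStability` (v3 (B); all on `ℝ³` / `Q := (ℝ³×ℝ³)×S²`)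

Conventions shared by all four (VERBATIM those of `ParityStability`, `ParityRigidity`, p138663, p139366, p137939):
`h^ν_ϑ(v) = ∫ localMaxwellian 1 ϑ² v v' dν(v')` (Gaussian KDE of the law `ν` at bandwidth `ϑ`),
`F^ν_ϑ(q) = log h(q.1.1) + log h(q.1.2) − log h((collide q.2 q.1).1) − log h((collide q.2 q.1).2)` (surprisal jump,
`q.1` = PRE pair, `collide q.2 q.1` = POST pair), `J q = (collide q.2 q.1, −q.2)` (inverse collision, an involution:
`inverseCollision_inverseCollision`), `B q = hardSphereKernel (q.1.2, q.1.1) q.2 = ((w − v)·ω)₊`,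
`π(ν) = B · ((ν ⊗ ν) ⊗ σ)`, `σ = sphereMeasure`. -/

/-- Registered stub signature (waypoint, skeleton v3 of line `transfer-weighted-parity-chain`, crux
`ParityBandClosure`, stmt-AtomisticToContinuum-17608; route-internal, not a cited fact; body VERBATIM):
**Exact parity rigidity** (the `η = 0` case of `ParityStability`; OWN waypoint of v3).  A probability law `ν` on `ℝ³`
with finite second moment and a finite record `κ` on `Q` with finite second moments such that (o) at EVERY bandwidth
`ϑ ∈ (0,1)` every bounded continuous `J`-odd test integrates to zero against the Metropolis-reweighted record
`min(1,e^{−F^ν_ϑ})·κ`, (f) the ideal contact law `π(ν) = B·((ν⊗ν)⊗σ)` is absolutely continuous w.r.t. `κ`, and (b) the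
record is collisionally balanced as a MEASURE identity (gain marginals = loss marginals on `ℝ³`), has EXACTLY isotropic
central second moments.  Proof = the landed chain: (o) ⇒ `J`-invariance of the reweighted record (p139072
`stub_mapInverseCollisionOfOddIntegrals`); (b) + `|log h_ϑ(v)| ≤ C_ϑ(1+|v|²)` + energy conservation of `collide` ⇒
`F_ϑ` is `κ`-integrable with `∫F_ϑ dκ = 0` (`integral_map` four times); `F_ϑ ∘ J = −F_ϑ` (`collide_neg_dir`,
`collide_collide`); p138663 `stub_detailedBalanceOfSymmetricRecord` with (f) ⇒ `F_ϑ = 0` `π(ν)`-a.e.; p139366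
`stub_productionZeroOfDetailedBalance` ⇒ the even production vanishes at every `ϑ ∈ (0,1)`; p137939
`stub_isotropyOfVanishingProduction` (`ϑ₀ = 1`) ⇒ isotropy.  Analytic facts on `h_ϑ`: `ParityRigidityMollify`
(`integral_localMaxwellian_pos`, `measurable_integral_localMaxwellian`, `integral_localMaxwellian_eq`, `surprisal_eq`). -/
def ExactParityRigidity : Prop :=
  ∀ (ν : Measure V3) [IsProbabilityMeasure ν] (κ : Measure ((V3 × V3) × Metric.sphere (0 : V3) 1))
    [IsFiniteMeasure κ],
    Integrable (fun v : V3 => ‖v‖ ^ 2) ν →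
    Integrable (fun q : (V3 × V3) × Metric.sphere (0 : V3) 1 => ‖q.1.1‖ ^ 2 + ‖q.1.2‖ ^ 2) κ →
    let h : ℝ → V3 → ℝ := fun ϑ v => ∫ v', localMaxwellian 1 (ϑ ^ 2) v v' ∂ν
    let F : ℝ → (V3 × V3) × Metric.sphere (0 : V3) 1 → ℝ := fun ϑ q =>
      Real.log (h ϑ q.1.1) + Real.log (h ϑ q.1.2) -
        Real.log (h ϑ (collide q.2 q.1).1) - Real.log (h ϑ (collide q.2 q.1).2)
    (∀ ϑ : ℝ, 0 < ϑ → ϑ < 1 → ∀ Ψ : (V3 × V3) × Metric.sphere (0 : V3) 1 → ℝ, Continuous Ψ →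
      (∃ C : ℝ, ∀ q, |Ψ q| ≤ C) → (∀ q, Ψ (collide q.2 q.1, -q.2) = -Ψ q) →
      ∫ q, Ψ q * min 1 (Real.exp (-(F ϑ q))) ∂κ = 0) →
    (((ν.prod ν).prod sphereMeasure).withDensity
        (fun q => ENNReal.ofReal (hardSphereKernel (q.1.2, q.1.1) q.2))) ≪ κ →
    κ.map (fun q => (collide q.2 q.1).1) + κ.map (fun q => (collide q.2 q.1).2) =
      κ.map (fun q => q.1.1) + κ.map (fun q => q.1.2) →
    ∃ θ : ℝ, 0 ≤ θ ∧ ∃ u : V3, (∀ j : Fin 3, ∫ v, v j ∂ν = u j) ∧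
      ∀ j k : Fin 3, ∫ v, (v j - u j) * (v k - u k) ∂ν = (if j = k then θ else 0)

/-- Registered stub signature (waypoint, skeleton v3 of line `transfer-weighted-parity-chain`, crux
`ParityBandClosure`, stmt-AtomisticToContinuum-17608; route-internal, not a cited fact; body VERBATIM):
**Joint weak continuity of the Metropolis-odd test functional at fixed bandwidth** (OWN waypoint of v3).  Along
`ν_n → ν` weakly (probability laws on `ℝ³` with second moments `≤ M`) and `κ_n → κ` weakly (finite records on `Q` with
second moments `≤ M`), for every `ϑ ∈ (0,1)` and every bounded continuous `Ψ`:
`∫ Ψ min(1, e^{−F^{ν_n}_ϑ}) dκ_n → ∫ Ψ min(1, e^{−F^ν_ϑ}) dκ`.  Proof: `h^{ν_n}_ϑ → h^ν_ϑ` pointwise (bounded continuous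
Gaussian integrand) and `{h^{ν_n}_ϑ}` is equi-Lipschitz (`‖∇G_ϑ‖_∞ < ∞`), hence locally uniform convergence; tightness of
`(ν_n)` (Markov on the second moments) gives `h^{ν_n}_ϑ ≥ c(K) > 0` on compacts uniformly in `n`, so `F^{ν_n}_ϑ → F^ν_ϑ`
uniformly on compacts of `Q` (`collide` continuous); `x ↦ min(1,e^{−x})` is 1-Lipschitz and the integrand is bounded by
`sup|Ψ|`; tightness of `(κ_n)` (Markov) + `κ_n → κ` on the bounded continuous limit integrand finish. -/
def SurprisalTestContinuity : Prop :=
  ∀ (M : ℝ) (νs : ℕ → ProbabilityMeasure V3) (ν : ProbabilityMeasure V3)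
    (κs : ℕ → FiniteMeasure ((V3 × V3) × Metric.sphere (0 : V3) 1))
    (κ : FiniteMeasure ((V3 × V3) × Metric.sphere (0 : V3) 1)),
    Tendsto νs atTop (𝓝 ν) → Tendsto κs atTop (𝓝 κ) →
    (∀ n, Integrable (fun v : V3 => ‖v‖ ^ 2) (νs n : Measure V3) ∧
      ∫ v, ‖v‖ ^ 2 ∂(νs n : Measure V3) ≤ M) →
    (∀ n, Integrable (fun q : (V3 × V3) × Metric.sphere (0 : V3) 1 => ‖q.1.1‖ ^ 2 + ‖q.1.2‖ ^ 2)
        (κs n : Measure ((V3 × V3) × Metric.sphere (0 : V3) 1)) ∧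
      ∫ q, (‖q.1.1‖ ^ 2 + ‖q.1.2‖ ^ 2) ∂(κs n : Measure ((V3 × V3) × Metric.sphere (0 : V3) 1)) ≤ M) →
    ∀ ϑ : ℝ, 0 < ϑ → ϑ < 1 → ∀ Ψ : (V3 × V3) × Metric.sphere (0 : V3) 1 → ℝ, Continuous Ψ →
      (∃ C : ℝ, ∀ q, |Ψ q| ≤ C) →
      let h : Measure V3 → V3 → ℝ := fun μ v => ∫ v', localMaxwellian 1 (ϑ ^ 2) v v' ∂μ
      let F : Measure V3 → (V3 × V3) × Metric.sphere (0 : V3) 1 → ℝ := fun μ q =>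
        Real.log (h μ q.1.1) + Real.log (h μ q.1.2) -
          Real.log (h μ (collide q.2 q.1).1) - Real.log (h μ (collide q.2 q.1).2)
      Tendsto (fun n => ∫ q, Ψ q * min 1 (Real.exp (-(F (νs n : Measure V3) q)))
          ∂(κs n : Measure ((V3 × V3) × Metric.sphere (0 : V3) 1))) atTop
        (𝓝 (∫ q, Ψ q * min 1 (Real.exp (-(F (ν : Measure V3) q)))
          ∂(κ : Measure ((V3 × V3) × Metric.sphere (0 : V3) 1))))

/-- Registered stub signature (waypoint, skeleton v3 of line `transfer-weighted-parity-chain`, crux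
`ParityBandClosure`, stmt-AtomisticToContinuum-17608; route-internal, not a cited fact; body VERBATIM):
**Moments and the floor along weakly convergent sequences** (OWN waypoint of v3; standard truncation / uniform
integrability facts, packaged).  ν-part: along `ν_n → ν` weakly with `∫|v|³dν_n ≤ M` (integrable): the limit has
`∫|v|³dν ≤ M` (lower semicontinuity: `|v|³ ∧ k` is bounded continuous, monotone convergence in `k`), first and second
coordinate moments CONVERGE (uniform integrability from the cubic bound: truncate at `|v| ≤ R`, tails `≤ M/R`), and for
nonneg bounded continuous `Ξ` the floor integral `∫ Ξ B d((ν⊗ν)⊗σ)` is lower semicontinuous along the sequence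
(`ν_n ⊗ ν_n → ν ⊗ ν` weakly: `ProbabilityMeasure`/`FiniteMeasure.continuous_prod`; then `⊗ σ`, `σ` finite; `Ξ B ∧ k`
bounded continuous; `B ≤ |v| + |w|` integrable).  κ-part: along `κ_n → κ` weakly (finite measures on `Q`) with second
moments `≤ M` and mass `≤ M`, the limit has the same bounds (lsc / continuity of the mass). -/
def MomentSemicontinuity : Prop :=
  (∀ (M : ℝ) (νs : ℕ → ProbabilityMeasure V3) (ν : ProbabilityMeasure V3), Tendsto νs atTop (𝓝 ν) →
    (∀ n, Integrable (fun v : V3 => ‖v‖ ^ 3) (νs n : Measure V3) ∧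
      ∫ v, ‖v‖ ^ 3 ∂(νs n : Measure V3) ≤ M) →
    (Integrable (fun v : V3 => ‖v‖ ^ 3) (ν : Measure V3) ∧ ∫ v, ‖v‖ ^ 3 ∂(ν : Measure V3) ≤ M) ∧
    (∀ j : Fin 3, Tendsto (fun n => ∫ v, v j ∂(νs n : Measure V3)) atTop (𝓝 (∫ v, v j ∂(ν : Measure V3)))) ∧
    (∀ j k : Fin 3, Tendsto (fun n => ∫ v, v j * v k ∂(νs n : Measure V3)) atTop
      (𝓝 (∫ v, v j * v k ∂(ν : Measure V3)))) ∧
    (∀ Ξ : (V3 × V3) × Metric.sphere (0 : V3) 1 → ℝ, Continuous Ξ → (∀ q, 0 ≤ Ξ q) →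
      (∃ C : ℝ, ∀ q, Ξ q ≤ C) → ∀ (b : ℕ → ℝ) (c : ℝ), Tendsto b atTop (𝓝 c) →
      (∀ n, ∫ q, Ξ q * hardSphereKernel (q.1.2, q.1.1) q.2
          ∂(((νs n : Measure V3).prod (νs n : Measure V3)).prod sphereMeasure) ≤ b n) →
      ∫ q, Ξ q * hardSphereKernel (q.1.2, q.1.1) q.2
          ∂(((ν : Measure V3).prod (ν : Measure V3)).prod sphereMeasure) ≤ c)) ∧
  (∀ (M : ℝ) (κs : ℕ → FiniteMeasure ((V3 × V3) × Metric.sphere (0 : V3) 1))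
    (κ : FiniteMeasure ((V3 × V3) × Metric.sphere (0 : V3) 1)), Tendsto κs atTop (𝓝 κ) →
    (∀ n, Integrable (fun q : (V3 × V3) × Metric.sphere (0 : V3) 1 => ‖q.1.1‖ ^ 2 + ‖q.1.2‖ ^ 2)
        (κs n : Measure ((V3 × V3) × Metric.sphere (0 : V3) 1)) ∧
      ∫ q, (‖q.1.1‖ ^ 2 + ‖q.1.2‖ ^ 2) ∂(κs n : Measure ((V3 × V3) × Metric.sphere (0 : V3) 1)) ≤ M ∧
      ((κs n : Measure ((V3 × V3) × Metric.sphere (0 : V3) 1)) Set.univ).toReal ≤ M) →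
    Integrable (fun q : (V3 × V3) × Metric.sphere (0 : V3) 1 => ‖q.1.1‖ ^ 2 + ‖q.1.2‖ ^ 2)
        (κ : Measure ((V3 × V3) × Metric.sphere (0 : V3) 1)) ∧
      ∫ q, (‖q.1.1‖ ^ 2 + ‖q.1.2‖ ^ 2) ∂(κ : Measure ((V3 × V3) × Metric.sphere (0 : V3) 1)) ≤ M ∧
      ((κ : Measure ((V3 × V3) × Metric.sphere (0 : V3) 1)) Set.univ).toReal ≤ M)

/-- Registered stub signature (waypoint, skeleton v3 of line `transfer-weighted-parity-chain`, crux
`ParityBandClosure`, stmt-AtomisticToContinuum-17608; route-internal, not a cited fact; body VERBATIM):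
**Countable determining test families** (OWN waypoint of v3).  There are countably many bounded continuous `Φ_i` on
`Q`, nonneg bounded continuous `Ξ_i` on `Q`, bounded continuous `c_i` on `ℝ³` and bandwidths `ϑ_k ∈ (0,1)` such that,
for every probability law `ν` with finite second moment, every finite record `κ` and every `c₀ > 0`, the EXACT countable
identities — (o) `∫ (Φ_i − Φ_i ∘ J) min(1,e^{−F^ν_{ϑ_k}}) dκ = 0` for all `i,k`; (f) `c₀ ∫ Ξ_i B d((ν⊗ν)⊗σ) ≤ ∫ Ξ_i dκ`
for all `i`; (b) `∫ Δc_i dκ = 0` for all `i` — imply the three hypotheses of `ExactParityRigidity`.  Proof: (o) `Φ_i` :=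
the monomials in a countable point-separating family of bounded continuous functions on the Polish space `Q` — a
countable set whose linear span is a separating subalgebra, so `ext_of_forall_mem_subalgebra_integral_eq_of_polish`
gives `J`-invariance of `min(1,e^{−F_{ϑ_k}})·κ` (finite) at each `ϑ_k` (alternatively `Measure.ext_of_charFun` through
the embedding `Q ⊂ ℝ⁹`), hence vanishing of all `J`-odd integrals at `ϑ_k` (`integral_map`); `{ϑ_k}` dense in `(0,1)`
(e.g. the rationals) and `ϑ ↦ ∫ Ψ min(1,e^{−F^ν_ϑ}) dκ` continuous on `(0,1)` (dominated convergence: `h_ϑ(v)` is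
continuous in `ϑ > 0` and positive) give all `ϑ`.  (f) `Ξ_i` := `1 − (IsClosed.apprSeq Vᶜ m)` for `V` in a countable
family of open sets closed under finite unions and containing a countable base: monotone convergence gives
`c₀ π(V) ≤ κ(V)` on that family, then on all open sets (increasing unions), then `π ≪ κ` by outer regularity of the finite
measure `κ` on the metric space `Q`.  (b) `c_i` := a countable determining family on `ℝ³` as in (o): the four
push-forwards are finite measures with `∫ c_i d(gain) = ∫ c_i d(loss)` for all `i`. -/
def CountableTestUpgrade : Prop :=
  ∃ (Φ₀ : ℕ → (V3 × V3) × Metric.sphere (0 : V3) 1 → ℝ)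
    (Ξ₀ : ℕ → (V3 × V3) × Metric.sphere (0 : V3) 1 → ℝ) (C₀ : ℕ → V3 → ℝ) (ϑ₀ : ℕ → ℝ),
    (∀ i, Continuous (Φ₀ i) ∧ ∃ C : ℝ, ∀ q, |Φ₀ i q| ≤ C) ∧
    (∀ i, Continuous (Ξ₀ i) ∧ (∀ q, 0 ≤ Ξ₀ i q) ∧ ∃ C : ℝ, ∀ q, Ξ₀ i q ≤ C) ∧
    (∀ i, Continuous (C₀ i) ∧ ∃ C : ℝ, ∀ v, |C₀ i v| ≤ C) ∧
    (∀ k, 0 < ϑ₀ k ∧ ϑ₀ k < 1) ∧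
    ∀ (ν : Measure V3) [IsProbabilityMeasure ν] (κ : Measure ((V3 × V3) × Metric.sphere (0 : V3) 1))
      [IsFiniteMeasure κ] (c₀ : ℝ), 0 < c₀ →
      Integrable (fun v : V3 => ‖v‖ ^ 2) ν →
      let h : ℝ → V3 → ℝ := fun ϑ v => ∫ v', localMaxwellian 1 (ϑ ^ 2) v v' ∂ν
      let F : ℝ → (V3 × V3) × Metric.sphere (0 : V3) 1 → ℝ := fun ϑ q =>
        Real.log (h ϑ q.1.1) + Real.log (h ϑ q.1.2) -
          Real.log (h ϑ (collide q.2 q.1).1) - Real.log (h ϑ (collide q.2 q.1).2)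
      (∀ i k, ∫ q, (Φ₀ i q - Φ₀ i (collide q.2 q.1, -q.2)) * min 1 (Real.exp (-(F (ϑ₀ k) q))) ∂κ = 0) →
      (∀ i, c₀ * ∫ q, Ξ₀ i q * hardSphereKernel (q.1.2, q.1.1) q.2 ∂((ν.prod ν).prod sphereMeasure) ≤
        ∫ q, Ξ₀ i q ∂κ) →
      (∀ i, ∫ q, (C₀ i (collide q.2 q.1).1 + C₀ i (collide q.2 q.1).2 - C₀ i q.1.1 - C₀ i q.1.2) ∂κ = 0) →
      (∀ ϑ : ℝ, 0 < ϑ → ϑ < 1 → ∀ Ψ : (V3 × V3) × Metric.sphere (0 : V3) 1 → ℝ, Continuous Ψ →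
        (∃ C : ℝ, ∀ q, |Ψ q| ≤ C) → (∀ q, Ψ (collide q.2 q.1, -q.2) = -Ψ q) →
        ∫ q, Ψ q * min 1 (Real.exp (-(F ϑ q))) ∂κ = 0) ∧
      (((ν.prod ν).prod sphereMeasure).withDensity
          (fun q => ENNReal.ofReal (hardSphereKernel (q.1.2, q.1.1) q.2)) ≪ κ) ∧
      (κ.map (fun q => (collide q.2 q.1).1) + κ.map (fun q => (collide q.2 q.1).2) =
        κ.map (fun q => q.1.1) + κ.map (fun q => q.1.2))
/-! ## §2 The assembly -/

/-- **STUB `stub_parityStabilityOfRigidity`** (line `transfer-weighted-parity-chain`, crux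
`JParityClosure.ParityBandClosure`, stmt-AtomisticToContinuum-17608): the compactness assembly —
`ParityStability` from exact rigidity, joint weak continuity of the Metropolis-odd functional,
moment (semi)continuity and the countable test upgrade.  Proof (1)–(6) of the module docstring. -/
theorem stub_parityStabilityOfRigidity :
    ExactParityRigidity → SurprisalTestContinuity → MomentSemicontinuity → CountableTestUpgrade →
    ParityStability := by
  intro hR hC hM hU M cmin ε hcmin hε
  obtain ⟨Φ₀, Ξ₀, C₀, ϑ₀, hΦ, hΞ, hC0, hϑ, hup⟩ := hU
  /- The surprisal jump `F^μ_ϑ(q) = log h(v) + log h(w) − log h(v′) − log h(w′)`, `h = μ ⋆ G_{ϑ²}`,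
  as a function of the law `μ` (the `let F` of the waypoints, definitionally). -/
  let Fs : Measure V3 → ℝ → (V3 × V3) × Metric.sphere (0 : V3) 1 → ℝ := fun μ ϑ q =>
    Real.log (∫ v', localMaxwellian 1 (ϑ ^ 2) q.1.1 v' ∂μ) +
        Real.log (∫ v', localMaxwellian 1 (ϑ ^ 2) q.1.2 v' ∂μ) -
      Real.log (∫ v', localMaxwellian 1 (ϑ ^ 2) (collide q.2 q.1).1 v' ∂μ) -
    Real.log (∫ v', localMaxwellian 1 (ϑ ^ 2) (collide q.2 q.1).2 v' ∂μ)
  by_contra hneg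
  /- (1) Stage `n`: the first `n` countable tests with tolerance `1/(n+1)` fail for some triple. -/
  have stage : ∀ n : ℕ, ∃ (P : ProbabilityMeasure V3)
      (K : FiniteMeasure ((V3 × V3) × Metric.sphere (0 : V3) 1)) (c₀ : ℝ),
      cmin ≤ c₀ ∧ Integrable (fun v : V3 => ‖v‖ ^ 3) (P : Measure V3) ∧
      ∫ v, ‖v‖ ^ 3 ∂(P : Measure V3) ≤ M ∧
      ((K : Measure ((V3 × V3) × Metric.sphere (0 : V3) 1)) Set.univ).toReal ≤ M ∧
      Integrable (fun q : (V3 × V3) × Metric.sphere (0 : V3) 1 => ‖q.1.1‖ ^ 2 + ‖q.1.2‖ ^ 2)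
        (K : Measure ((V3 × V3) × Metric.sphere (0 : V3) 1)) ∧
      ∫ q, (‖q.1.1‖ ^ 2 + ‖q.1.2‖ ^ 2) ∂(K : Measure ((V3 × V3) × Metric.sphere (0 : V3) 1)) ≤ M ∧
      (∀ j : Fin n, |∫ q, (Φ₀ (Nat.unpair j).1 q - Φ₀ (Nat.unpair j).1 (collide q.2 q.1, -q.2)) *
          min 1 (Real.exp (-(Fs (P : Measure V3) (ϑ₀ (Nat.unpair j).2) q)))
            ∂(K : Measure ((V3 × V3) × Metric.sphere (0 : V3) 1))| ≤ 1 / ((n : ℝ) + 1)) ∧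
      (∀ j : Fin n, c₀ * ∫ q, Ξ₀ j q * hardSphereKernel (q.1.2, q.1.1) q.2
          ∂(((P : Measure V3).prod (P : Measure V3)).prod sphereMeasure) ≤
        (∫ q, Ξ₀ j q ∂(K : Measure ((V3 × V3) × Metric.sphere (0 : V3) 1))) + 1 / ((n : ℝ) + 1)) ∧
      (∀ j : Fin n, |∫ q, (C₀ j (collide q.2 q.1).1 + C₀ j (collide q.2 q.1).2 - C₀ j q.1.1 -
          C₀ j q.1.2) ∂(K : Measure ((V3 × V3) × Metric.sphere (0 : V3) 1))| ≤ 1 / ((n : ℝ) + 1)) ∧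
      ¬ ∃ θ : ℝ, 0 ≤ θ ∧ ∃ u : V3, (∀ j : Fin 3, |(∫ v, v j ∂(P : Measure V3)) - u j| ≤ ε) ∧
        ∀ j k : Fin 3, |(∫ v, (v j - u j) * (v k - u k) ∂(P : Measure V3)) -
          (if j = k then θ else 0)| ≤ ε := by
    intro n
    by_contra hn
    refine hneg ⟨n, fun j q => Φ₀ (Nat.unpair j).1 q - Φ₀ (Nat.unpair j).1 (collide q.2 q.1, -q.2),
      fun j => Ξ₀ j, fun j => C₀ j, fun j => ϑ₀ (Nat.unpair j).2, 1 / ((n : ℝ) + 1), by positivity,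
      fun j => oddTest_props _ (hΦ _).1 (hΦ _).2, fun j => hΞ j, fun j => hC0 j, fun j => hϑ _,
      ?_⟩
    intro ν hν κ hκ c₀ hc₀ hi3 h3 hmass hi2 h2 h F ho hf hb
    by_contra hfail
    exact hn ⟨⟨ν, hν⟩, ⟨κ, hκ⟩, c₀, hc₀, hi3, h3, hmass, hi2, h2, ho, hf, hb, hfail⟩
  choose P K c₀ hc₀ hP3 hPM hKmass hK2 hKM ho hf hb hfail using stage
  /- (2) Extraction of a jointly weakly convergent subsequence. -/
  obtain ⟨φ, hφ, ν, κ, hPl, hKl⟩ := exists_subseq_pair P K hP3 hPM hKmass hK2 hKM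
  have hφle : ∀ n, n ≤ φ n := fun n => hφ.id_le n
  /- (3) Moment bounds of the limit pair and of the subsequence. -/
  obtain ⟨⟨hν3, hν3M⟩, hm1, hm2, -⟩ := hM.1 M (P ∘ φ) ν hPl fun n => ⟨hP3 (φ n), hPM (φ n)⟩
  obtain ⟨hκ2, -, -⟩ := hM.2 M (K ∘ φ) κ hKl fun n => ⟨hK2 (φ n), hKM (φ n), hKmass (φ n)⟩
  obtain ⟨hν2, -⟩ := integrable_sq_of_cube (ν : Measure V3) hν3 hν3M
  have hb1 : ∀ n, Integrable (fun v : V3 => ‖v‖ ^ 2) ((P ∘ φ) n : Measure V3) ∧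
      ∫ v, ‖v‖ ^ 2 ∂((P ∘ φ) n : Measure V3) ≤ M + 1 :=
    fun n => integrable_sq_of_cube (P (φ n) : Measure V3) (hP3 (φ n)) (hPM (φ n))
  have hb2 : ∀ n, Integrable (fun q : (V3 × V3) × Metric.sphere (0 : V3) 1 =>
      ‖q.1.1‖ ^ 2 + ‖q.1.2‖ ^ 2) ((K ∘ φ) n : Measure ((V3 × V3) × Metric.sphere (0 : V3) 1)) ∧
      ∫ q, (‖q.1.1‖ ^ 2 + ‖q.1.2‖ ^ 2)
        ∂((K ∘ φ) n : Measure ((V3 × V3) × Metric.sphere (0 : V3) 1)) ≤ M + 1 :=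
    fun n => ⟨hK2 (φ n), (hKM (φ n)).trans (by linarith)⟩
  /- (4) Exact limit identities: (o) by joint weak continuity, (b) by weak convergence, (f) by the
  floor semicontinuity along the shifted subsequence; tolerances `1/(φ n + 1) → 0`. -/
  have ho_lim : ∀ i k, ∫ q, (Φ₀ i q - Φ₀ i (collide q.2 q.1, -q.2)) *
      min 1 (Real.exp (-(Fs (ν : Measure V3) (ϑ₀ k) q)))
        ∂(κ : Measure ((V3 × V3) × Metric.sphere (0 : V3) 1)) = 0 := by
    intro i k
    obtain ⟨hΨc, hΨb, -⟩ := oddTest_props _ (hΦ i).1 (hΦ i).2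
    have hconv : Tendsto (fun n => ∫ q, (Φ₀ i q - Φ₀ i (collide q.2 q.1, -q.2)) *
        min 1 (Real.exp (-(Fs ((P ∘ φ) n : Measure V3) (ϑ₀ k) q)))
          ∂((K ∘ φ) n : Measure ((V3 × V3) × Metric.sphere (0 : V3) 1))) atTop
        (𝓝 (∫ q, (Φ₀ i q - Φ₀ i (collide q.2 q.1, -q.2)) *
          min 1 (Real.exp (-(Fs (ν : Measure V3) (ϑ₀ k) q)))
            ∂(κ : Measure ((V3 × V3) × Metric.sphere (0 : V3) 1)))) :=
      hC (M + 1) (P ∘ φ) ν (K ∘ φ) κ hPl hKl hb1 hb2 (ϑ₀ k) (hϑ k).1 (hϑ k).2 _ hΨc hΨb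
    refine limit_eq_zero_of_abs_le hconv (tendsto_one_div_subseq hφ)
      (Filter.eventually_atTop.2 ⟨Nat.pair i k + 1, fun n hn => ?_⟩)
    have := ho (φ n) ⟨Nat.pair i k, lt_of_lt_of_le hn (hφle n)⟩
    simpa only [Function.comp_apply, Nat.unpair_pair] using this
  have hb_lim : ∀ i, ∫ q, (C₀ i (collide q.2 q.1).1 + C₀ i (collide q.2 q.1).2 - C₀ i q.1.1 -
      C₀ i q.1.2) ∂(κ : Measure ((V3 × V3) × Metric.sphere (0 : V3) 1)) = 0 := by
    intro i
    obtain ⟨hcont, hbdd⟩ := balanceTest_props (C₀ i) (hC0 i).1 (hC0 i).2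
    refine limit_eq_zero_of_abs_le (tendsto_integral_of_tendsto hKl _ hcont hbdd)
      (tendsto_one_div_subseq hφ) (Filter.eventually_atTop.2 ⟨i + 1, fun n hn => ?_⟩)
    exact hb (φ n) ⟨i, lt_of_lt_of_le hn (hφle n)⟩
  have hf_lim : ∀ i, cmin * ∫ q, Ξ₀ i q * hardSphereKernel (q.1.2, q.1.1) q.2
      ∂(((ν : Measure V3).prod (ν : Measure V3)).prod sphereMeasure) ≤
      ∫ q, Ξ₀ i q ∂(κ : Measure ((V3 × V3) × Metric.sphere (0 : V3) 1)) := by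
    intro i
    obtain ⟨hΞc, hΞ0, C, hC'⟩ := hΞ i
    have hsh := tendsto_add_atTop_nat (i + 1)
    have hbseq : Tendsto (fun m =>
        ((∫ q, Ξ₀ i q ∂(K (φ (m + (i + 1))) : Measure ((V3 × V3) × Metric.sphere (0 : V3) 1))) +
          1 / ((φ (m + (i + 1)) : ℝ) + 1)) / cmin) atTop
        (𝓝 (((∫ q, Ξ₀ i q ∂(κ : Measure ((V3 × V3) × Metric.sphere (0 : V3) 1))) + 0) / cmin)) :=
      (((tendsto_integral_of_tendsto hKl _ hΞc
        ⟨C, fun q => abs_le.mpr ⟨by linarith [hΞ0 q, hC' q], hC' q⟩⟩).comp hsh).add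
        ((tendsto_one_div_subseq hφ).comp hsh)).div_const cmin
    have hbound : ∀ m, ∫ q, Ξ₀ i q * hardSphereKernel (q.1.2, q.1.1) q.2
        ∂(((P (φ (m + (i + 1))) : Measure V3).prod (P (φ (m + (i + 1))) : Measure V3)).prod
          sphereMeasure) ≤
        ((∫ q, Ξ₀ i q ∂(K (φ (m + (i + 1))) : Measure ((V3 × V3) × Metric.sphere (0 : V3) 1))) +
          1 / ((φ (m + (i + 1)) : ℝ) + 1)) / cmin :=
      fun m => floor_le_div (integral_nonneg fun q => mul_nonneg (hΞ0 q) (le_max_right _ _)) hcmin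
        (hc₀ _) (hf (φ (m + (i + 1))) ⟨i, lt_of_lt_of_le (by omega) (hφle _)⟩)
    have key := (hM.1 M (fun m => P (φ (m + (i + 1)))) ν (hPl.comp hsh)
      (fun m => ⟨hP3 _, hPM _⟩)).2.2.2 (Ξ₀ i) hΞc hΞ0 ⟨C, hC'⟩ _ _ hbseq hbound
    rw [add_zero, le_div_iff₀ hcmin, mul_comm] at key
    exact key
  /- (5) The countable identities upgrade to the exact hypotheses; exact rigidity applies. -/
  obtain ⟨hodd, hac, hbal⟩ := hup (ν : Measure V3)
    (κ : Measure ((V3 × V3) × Metric.sphere (0 : V3) 1)) cmin hcmin hν2 ho_lim hf_lim hb_lim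
  obtain ⟨θ, hθ, u, hmean, hcov⟩ := hR (ν : Measure V3)
    (κ : Measure ((V3 × V3) × Metric.sphere (0 : V3) 1)) hν2 hκ2 hodd hac hbal
  /- (6) Moment convergence contradicts the failure of stage `φ n` for `n` large. -/
  have hev1 : ∀ j : Fin 3, ∀ᶠ n in atTop, |(∫ v, v j ∂((P ∘ φ) n : Measure V3)) - u j| < ε := by
    intro j
    have := hm1 j
    rw [hmean j] at this
    exact (Metric.tendsto_nhds.mp this ε hε).mono fun n h => by rwa [Real.dist_eq] at h
  have hev2 : ∀ jk : Fin 3 × Fin 3, ∀ᶠ n in atTop,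
      |(∫ v, (v jk.1 - u jk.1) * (v jk.2 - u jk.2) ∂((P ∘ φ) n : Measure V3)) -
        (if jk.1 = jk.2 then θ else 0)| < ε := by
    intro jk
    have := tendsto_central (P ∘ φ) ν (fun n => hP3 (φ n)) hν3 u jk.1 jk.2 (hm1 _) (hm1 _)
      (hm2 _ _)
    rw [hcov jk.1 jk.2] at this
    exact (Metric.tendsto_nhds.mp this ε hε).mono fun n h => by rwa [Real.dist_eq] at h
  obtain ⟨n, hn1, hn2⟩ :=
    ((Filter.eventually_all.2 hev1).and (Filter.eventually_all.2 hev2)).exists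
  exact hfail (φ n) ⟨θ, hθ, u, fun j => (hn1 j).le, fun j k => (hn2 (j, k)).le⟩

end Summit.AtomisticToContinuum.HydrodynamicLimit.Theorems.ParityBandClosureStabilityAssembly

end
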